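import Literature.NumberTheory.Automorphic.UnitaryGroupUnipotentInvariantUnfolding
import Literature.NumberTheory.Automorphic.UnitaryGroupTorusCentreUnfolding
import Literature.NumberTheory.Automorphic.UnitaryGroupTorusCentreLatticeKAverage
import Literature.NumberTheory.Automorphic.UnitaryGroupCentreProfileFinite
import Literature.NumberTheory.Automorphic.UnitaryGroupHeisenbergPartTorusStage
import Literature.NumberTheory.Automorphic.IdeleClassSubgroupUnfolding
import Literature.NumberTheory.Automorphic.IdeleClassGroupProofs
import HarnessLib

/-!
# The centre-lattice part of the unipotent term of `U(J₃)`: assembly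
# `∫_{G(𝔸)} β • ψ dν_G = C · μ_N(Ω) · ∫_{F^*·N(I_E)} ‖y‖⁻² • Φ(y) dμ_F` from the torus `K`-average
(Rogawski, *Automorphic Representations of Unitary Groups in Three Variables* (1990), §7.3, (7.3.2) and
Prop. 7.3.2 (c), (d) (pp. 96–97): after `G = NMK`, `dg = |δ_B(m)|⁻¹ dn dm dk` and «`m(N∖𝐍) = 1`», the terms with
`u = n(w)`, `w ∈ E⁰ ∖ 0`, of `Σ_{u ∈ N(F) − 1} f(g⁻¹ z u g)` give an integral over `𝐙M∖𝐌 → N E^*∖N I_E` of a lattice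
sum over `F^*`, which unfolds to `∫ f^K(z n(tδ₀)) ‖t‖² d^*t` over the norm classes; Arthur, *The trace formula in
invariant form*, Ann. of Math. 114 (1981), §2.)

Topic `NumberTheory/Automorphic`; namespace `Literature.NumberTheory.Automorphic.UnitaryGroup`. THEOREMS ONLY over
accepted tree modules (no definition, no named fact, no instance, no notation, no `sorry`). Row (L5-i) (C-γ)
«ASSEMBLY of the centre-lattice part» of the T1-qs LAW 5 road of `Cruxes/H413/Lines/F0_T1InnerFormTraceIdentity.lean`
(cell `pub/hodgecm-mathlib`, crux H413; B-p10 (g19) sub-cut 2026-08-31T13:14Z): the composition of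
★ (C-G) `exists_weight_torus_kAverage_of_unipotent_invariant` (group → torus for a left-`N(𝔸)`-, left-`B(F)`-invariant
integrand), ★ (C-K) `torusRootModulus_diagUnit_eq_ideleNorm_ideleRelNorm_sq` (`δ_B(t) = ‖N(d₀ t)‖_F²`) and ★ (C-P)
`exists_push_and_integral_comp_ideleRelNorm_diagUnitZero_eq` (torus → norm classes `F^* · N(I_E)`) with the lattice
unfolding ★ `setLIntegral_inter_tsum_smul_eq_setLIntegral` ∕ ★ `setIntegral_inter_tsum_smul_eq_setIntegral`, stated
FUNCTION-GENERICALLY in the torus `K`-average: whenever `∫_{K_U} ψ(t k) dμ_K = Σ_{k ∈ F^*} Φ(k · N(d₀ t))` (and, for the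
finiteness, `∫⁻_{K_U} ‖ψ(t k)‖ dμ_K ≤ Σ_{k ∈ F^*} Φ⁺(k · N(d₀ t))`), ONE constant `C > 0` gives

* (L) `∫⁻ β ‖ψ‖ dν_G ≤ C · μ_N(Ω) · ∫⁻_{y ∈ H} ‖y‖⁻² Φ⁺(y) dμ_F` — the engine of `hCfin : ∫⁻ β ‖ψᶜ‖ < ∞`;
* (B) `∫⁻ β ‖ψ‖ < ∞`, `‖·‖⁻² • Φ ∈ L¹(H)` ⟹ `β • ψ ∈ L¹(G(𝔸))` and
  `∫ β • ψ dν_G = C · μ_N(Ω) · ∫_{y ∈ H} ‖y‖⁻² • Φ(y) dμ_F` — the `(hCi, hCv)` of ★ (F)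
  `truncatedTraceClass_central_eq_linear_of_parts` once `ψ = ψᶜ` and `Φ = Φ_f` (★ (C-K));

and (§2–§3) AT THE CENTRE LATTICE SUM `ψᶜ_f(g) = Σ'_{w ∈ E⁻ ∖ 0} f(g⁻¹ z₁ n(w) g)` of a TEST FUNCTION `f ∈ C_c(G(𝔸))`,
UNCONDITIONALLY (all inputs ★: (C-K) `tsum_centre_conj_unipotent_mul` ∕ `tsum_centre_conj_borel_mul` ∕
`integral_tsum_centre_torus_mul_eq_tsum_principalIdeles` ∕ `measurable_centreProfile`, (E-G) `measurable_centrePart`,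
(C-γ-fin) `setLIntegral_ideleNorm_sq_inv_mul_centreProfile_lt_top` ∕ `integrableOn_ideleNorm_sq_inv_smul_centreProfile`):

* `lintegral_weight_mul_enorm_centrePart_lt_top_of_hasCompactSupport` — **`hCfin : ∫⁻ β ‖ψᶜ_f‖ dν_G < ∞`** (the
  hypothesis of ★ (E-GN) `exists_heisPart_integral_eq_torus` verbatim), given only `μ_N(Ω) < ∞`;
* `exists_integrable_and_integral_weight_smul_centrePart_eq` — **`(hCi, hCv)`**:
  `∫ β • ψᶜ_f dν_G = C · μ_N(Ω) · ∫_{y ∈ H} (‖y‖²)⁻¹ • Φ_f(y) dμ_F`, `Φ_f(y) = ∫_{K_U} f(k⁻¹ z₁ n(θ(y⁻¹)) k) dμ_K`.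

LETTERS: ★ (C-G) `UnitaryGroupUnipotentInvariantUnfolding` VERBATIM (`νG, μB, μK, μT, μN, hBK, Ω, hΩ, hΩu, wT, hwT`,
`K_U = adelicVal⁻¹(K_∞ · GL₃(𝒪̂_E))`, `δ_B(t) = torusRootModulus E 3 (diagUnit t.2)`) ⧺ ★ (C-P)
`UnitaryGroupTorusCentreUnfolding` VERBATIM (`E = F(δ)`, `c δ = -δ ≠ 0`, `δ² = θ ∈ 𝓞 F ∖ 0`, Haar `μF` on `𝕀_F`,
`H = principalIdeles F ⊔ normIdeles F θ`, `N = AdeleRing.ideleRelNorm F E`, `d₀ t = diagUnit (↑t).2 0`);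
`‖y‖ = IdeleClassGroup.ideleNorm F y`; `β` a covering weight of `B(F)♯` (★ B1).

HC_CM is proved only modulo the 7 printed citations until rung 0 closes — nothing here bears on a summit statement.

## References
* J. D. Rogawski, *Automorphic Representations of Unitary Groups in Three Variables*, Ann. of Math. Stud. 123 (1990),
  §7.3, (7.3.2), Prop. 7.3.2 (pp. 96–97); §7.2 (p. 94) [Rogawski1990].
* J. Arthur, *The trace formula in invariant form*, Ann. of Math. 114 (1981), §2 [Arthur1981TraceFormulaInvariantForm].
* G. B. Folland, *A Course in Abstract Harmonic Analysis* (1995), §2.6 Thm. 2.49 [Folland1995].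
-/

set_option autoImplicit false

noncomputable section

open MeasureTheory MeasureTheory.Measure Set NumberField IsDedekindDomain
open Literature.MeasureTheory.Group
open Literature.NumberTheory.QuadraticForms (normIdeles)
open scoped ENNReal NNReal

namespace Literature.NumberTheory.Automorphic

namespace UnitaryGroup

variable {F E : Type} [Field F] [NumberField F] [Field E] [NumberField E] [Algebra F E]
  {c : E ≃ₐ[F] E}

/-! ## §0 Plumbing on `𝕀_F` -/

section Plumbing

/-- `‖k • y‖ = ‖y‖` for a principal idele `k` — the product formula (★ `ideleNorm_principal`).
[cite: CasselsFrohlichANT1967, Ch. II §12] -/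
theorem ideleNorm_principalIdeles_smul (k : GaloisRepresentations.principalIdeles F) (y : (AdeleRing (𝓞 F) F)ˣ) :
    IdeleClassGroup.ideleNorm F (k • y) = IdeleClassGroup.ideleNorm F y := by
  rw [Subgroup.smul_def, smul_eq_mul, map_mul, ideleNorm_principal k.2, one_mul]

/-- `y ↦ (‖y‖²)⁻¹` is Borel on `𝕀_F` (★ `continuous_ideleNorm_holds`). [cite: WeilBNT1967, Ch. IV §4 Thm. 5] -/
theorem measurable_ideleNorm_sq_inv [MeasurableSpace (AdeleRing (𝓞 F) F)ˣ] [BorelSpace (AdeleRing (𝓞 F) F)ˣ] :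
    Measurable fun y : (AdeleRing (𝓞 F) F)ˣ => ((IdeleClassGroup.ideleNorm F y ^ 2)⁻¹ : ℝ≥0) := by
  have h : Continuous (IdeleClassGroup.ideleNorm F) := continuous_ideleNorm_holds F
  exact (h.pow 2).measurable.inv

/-- A lattice sum `y ↦ Σ_{l ∈ F^*} Φ (l • y)` is `F^*`-invariant. [folklore] -/
private theorem tsum_principalIdeles_smul_mul_left {Z : Type*} [AddCommMonoid Z] [TopologicalSpace Z]
    (Φ : (AdeleRing (𝓞 F) F)ˣ → Z) (k : (AdeleRing (𝓞 F) F)ˣ) (hk : k ∈ GaloisRepresentations.principalIdeles F)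
    (y : (AdeleRing (𝓞 F) F)ˣ) :
    ∑' l : GaloisRepresentations.principalIdeles F, Φ (l • (k * y)) =
      ∑' l : GaloisRepresentations.principalIdeles F, Φ (l • y) := by
  rw [← (Equiv.mulRight (⟨k, hk⟩ : GaloisRepresentations.principalIdeles F)).tsum_eq
    (fun l : GaloisRepresentations.principalIdeles F => Φ (l • y))]
  refine tsum_congr fun l => ?_
  simp only [Equiv.coe_mulRight, Subgroup.smul_def, smul_eq_mul, Subgroup.coe_mul, mul_assoc]

end Plumbing

/-! ## §1 The assembly, function-generic in the torus `K`-average -/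

section Assembly

variable [Algebra.IsQuadraticExtension F E]
  [MeasurableSpace (quasiSplit F E c 3).Adelic] [BorelSpace (quasiSplit F E c 3).Adelic]
  [MeasurableSpace (AdeleRing (𝓞 F) F)ˣ] [BorelSpace (AdeleRing (𝓞 F) F)ˣ]

/-- **ASSEMBLY OF THE CENTRE-LATTICE PART, function-generic in the torus `K`-average.** For the quasi-split `U(J₃)`
of a quadratic `E = F(δ)/F` (`c² = 1`, `c ≠ 1`, `c δ = -δ ≠ 0`, `δ² = θ ∈ 𝓞 F ∖ 0`), Haar measures
`ν_G, μ_B, μ_K, μ_T, μ_N, μ_F`, the Iwasawa decomposition `hBK`, a measurable strict fundamental set `Ω` of `N(F)_N`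
and a covering weight `w_T` of `T(F)_T`, there is ONE constant `C > 0` such that, with `H = F^* ⊔ N(I_E)`,
`N = N_{E/F}`, `d₀ t` the first diagonal entry and `‖·‖` the idele norm of `F`:
(L) for every covering weight `β` of `B(F)♯`, every Borel `ψ : G(𝔸) → ℂ` with `ψ(n y) = ψ(y)` (`n ∈ N(𝔸)`) and
`ψ(b y) = ψ(y)` (`b ∈ B(F)`), and every Borel `Φ⁺ ≥ 0` on `𝕀_F` with
`∫⁻_{K_U} ‖ψ(t k)‖ dμ_K ≤ Σ_{k ∈ F^*} Φ⁺(k · N(d₀ t))` for all `t ∈ T(𝔸)`: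
`∫⁻ β ‖ψ‖ dν_G ≤ C · μ_N(Ω) · ∫⁻_{y ∈ H} (‖y‖²)⁻¹ Φ⁺(y) dμ_F`;
(B) for every such `β`, `ψ` with `∫⁻ β ‖ψ‖ dν_G < ∞` and every Borel `Φ : 𝕀_F → ℂ` with
`∫_{K_U} ψ(t k) dμ_K = Σ_{k ∈ F^*} Φ(k · N(d₀ t))` for all `t` and `(‖·‖²)⁻¹ • Φ ∈ L¹(H, μ_F)`:
`g ↦ (β g).toReal • ψ g` is `ν_G`-integrable and
**`∫ β • ψ dν_G = C · μ_N(Ω) · ∫_{y ∈ H} (‖y‖²)⁻¹ • Φ(y) dμ_F`** — Rogawski's (7.3.2) with Prop. 7.3.2 (c)+(d) BEFORE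
the index-two split `∫_H = ½ Σ_{χ ∈ {1, ω}} ∫_{I_F} χ`: `G = NMK`, `dg = |δ_B(m)|⁻¹ dn dm dk`, «`m(N∖𝐍) = 1`»
(★ `exists_weight_torus_kAverage_of_unipotent_invariant`), `δ_B(m) = ‖N a‖²` for `m = d(a, b, ā⁻¹)`
(★ `torusRootModulus_diagUnit_eq_ideleNorm_ideleRelNorm_sq`), `𝐙M∖𝐌 → N E^*∖N I_E` and the unfolding of the `F^*`-sum
(★ `exists_push_and_integral_comp_ideleRelNorm_diagUnitZero_eq`, ★ `setIntegral_inter_tsum_smul_eq_setIntegral`).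
[cite: Rogawski1990, §7.3 (7.3.2) and Prop. 7.3.2 (pp. 96–97)] [cite: Arthur1981TraceFormulaInvariantForm, §2]
[cite: Folland1995, §2.6 Thm. 2.49] -/
theorem exists_lintegral_le_and_integral_eq_of_torus_kAverage (hc : c * c = 1) (hc1 : c ≠ 1)
    {δ : E} (hcδ : c δ = -δ) (hδ : δ ≠ 0) (θ : 𝓞 F) (hθ : θ ≠ 0) (hd : δ * δ = algebraMap F E (θ : F))
    (νG : Measure (quasiSplit F E c 3).Adelic) [νG.IsHaarMeasure]
    (μB : Measure (borelAdelic F E c 3)) [μB.IsHaarMeasure]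
    (μK : Measure ((standardMaximalCompactGL 3 E).comap
      (adelicVal F E c 3 ((StdForm.antidiagonal 3).over E)) : Subgroup (quasiSplit F E c 3).Adelic))
    [μK.IsHaarMeasure]
    (μT : Measure (torusInBorel F E c 3)) [μT.IsHaarMeasure]
    (μN : Measure (unipotentInBorel F E c 3)) [μN.IsHaarMeasure]
    (hBK : ∀ g : (quasiSplit F E c 3).Adelic, ∃ b ∈ borelAdelic F E c 3, ∃ k : (quasiSplit F E c 3).Adelic,
      adelicVal F E c 3 ((StdForm.antidiagonal 3).over E) k ∈ standardMaximalCompactGL 3 E ∧ g = b * k)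
    {Ω : Set (unipotentInBorel F E c 3)} (hΩ : MeasurableSet Ω)
    (hΩu : ∀ n : unipotentInBorel F E c 3,
      ∃! ν : (((quasiSplit F E c 3).arithmeticSubgroup).subgroupOf (borelAdelic F E c 3)).subgroupOf
        (unipotentInBorel F E c 3), ν • n ∈ Ω)
    {wT : torusInBorel F E c 3 → ℝ≥0∞}
    (hwT : IsCoveringWeight ((((quasiSplit F E c 3).arithmeticSubgroup).subgroupOf (borelAdelic F E c 3)).subgroupOf
      (torusInBorel F E c 3)) wT)
    (μF : Measure (AdeleRing (𝓞 F) F)ˣ) [IsHaarMeasure μF] :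
    ∃ C : ℝ≥0, 0 < C ∧
      (∀ (β : (quasiSplit F E c 3).Adelic → ℝ≥0∞),
        IsCoveringWeight ((arithmeticBorel F E c 3).map (quasiSplit F E c 3).arithmeticSubgroup.subtype) β →
       ∀ ψ : (quasiSplit F E c 3).Adelic → ℂ, Measurable ψ →
        (∀ (n : unipotentInBorel F E c 3) (y : (quasiSplit F E c 3).Adelic),
          ψ (((n : borelAdelic F E c 3) : (quasiSplit F E c 3).Adelic) * y) = ψ y) →
        (∀ b ∈ arithmeticBorel F E c 3, ∀ y : (quasiSplit F E c 3).Adelic,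
          ψ ((b : (quasiSplit F E c 3).Adelic) * y) = ψ y) →
       ∀ Φ : (AdeleRing (𝓞 F) F)ˣ → ℝ≥0∞, Measurable Φ →
        (∀ t : torusInBorel F E c 3,
          ∫⁻ k, ‖ψ (((t : borelAdelic F E c 3) : (quasiSplit F E c 3).Adelic) * (k : (quasiSplit F E c 3).Adelic))‖ₑ ∂μK ≤
            ∑' k : GaloisRepresentations.principalIdeles F,
              Φ (k • AdeleRing.ideleRelNorm F E (diagUnit (t : borelAdelic F E c 3).2 0))) →
        ∫⁻ g, β g * ‖ψ g‖ₑ ∂νG ≤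
          (C : ℝ≥0∞) * μN Ω *
            ∫⁻ y in ↑(GaloisRepresentations.principalIdeles F ⊔ normIdeles F (θ : F)),
              (((IdeleClassGroup.ideleNorm F y ^ 2)⁻¹ : ℝ≥0) : ℝ≥0∞) * Φ y ∂μF) ∧
      (∀ (β : (quasiSplit F E c 3).Adelic → ℝ≥0∞),
        IsCoveringWeight ((arithmeticBorel F E c 3).map (quasiSplit F E c 3).arithmeticSubgroup.subtype) β →
       ∀ ψ : (quasiSplit F E c 3).Adelic → ℂ, Measurable ψ →
        (∀ (n : unipotentInBorel F E c 3) (y : (quasiSplit F E c 3).Adelic),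
          ψ (((n : borelAdelic F E c 3) : (quasiSplit F E c 3).Adelic) * y) = ψ y) →
        (∀ b ∈ arithmeticBorel F E c 3, ∀ y : (quasiSplit F E c 3).Adelic,
          ψ ((b : (quasiSplit F E c 3).Adelic) * y) = ψ y) →
        ∫⁻ g, β g * ‖ψ g‖ₑ ∂νG < ∞ →
       ∀ Φ : (AdeleRing (𝓞 F) F)ˣ → ℂ, Measurable Φ →
        (∀ t : torusInBorel F E c 3,
          ∫ k, ψ (((t : borelAdelic F E c 3) : (quasiSplit F E c 3).Adelic) * (k : (quasiSplit F E c 3).Adelic)) ∂μK =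
            ∑' k : GaloisRepresentations.principalIdeles F,
              Φ (k • AdeleRing.ideleRelNorm F E (diagUnit (t : borelAdelic F E c 3).2 0))) →
        IntegrableOn (fun y => (((IdeleClassGroup.ideleNorm F y ^ 2)⁻¹ : ℝ≥0) : ℝ) • Φ y)
          (↑(GaloisRepresentations.principalIdeles F ⊔ normIdeles F (θ : F))) μF →
        Integrable (fun g => (β g).toReal • ψ g) νG ∧
          ∫ g, (β g).toReal • ψ g ∂νG =
            ((C : ℝ) : ℂ) * (μN.real Ω : ℂ) *
              ∫ y in ↑(GaloisRepresentations.principalIdeles F ⊔ normIdeles F (θ : F)),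
                (((IdeleClassGroup.ideleNorm F y ^ 2)⁻¹ : ℝ≥0) : ℝ) • Φ y ∂μF) := by
  haveI : LocallyCompactSpace (AdeleRing (𝓞 E) E) := locallyCompactSpace_adeleRing' E
  -- the two ★ packages and an idele class domain of `F`
  obtain ⟨CG, hCG, hL, hB⟩ :=
    exists_weight_torus_kAverage_of_unipotent_invariant hc hc1 νG μB μK μT μN hBK hΩ hΩu hwT
  obtain ⟨CP, hCP0, hCPt, hP, hPB⟩ :=
    exists_push_and_integral_comp_ideleRelNorm_diagUnitZero_eq hc hc1 hcδ hδ θ hθ hd μT μF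
  obtain ⟨𝓕, h𝓕⟩ := exists_isIdeleClassDomain F
  have hwT' : IsCoveringWeight ((rationalBorel F E c 3).subgroupOf (torusInBorel F E c 3)) wT := hwT
  set H : Subgroup (AdeleRing (𝓞 F) F)ˣ := GaloisRepresentations.principalIdeles F ⊔ normIdeles F (θ : F) with hHdef
  have hle : GaloisRepresentations.principalIdeles F ≤ H := le_sup_left
  have hHm : MeasurableSet (H : Set (AdeleRing (𝓞 F) F)ˣ) :=
    GaloisRepresentations.measurableSet_principalIdeles_sup_normIdeles (K := F) (θ : F)
  -- `δ_B(t)⁻¹ = (‖N(d₀ t)‖²)⁻¹` (★ K4) and `‖k • y‖ = ‖y‖`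
  have hK4 : ∀ t : torusInBorel F E c 3,
      ((torusRootModulus E 3 (diagUnit (t : borelAdelic F E c 3).2))⁻¹ : ℝ≥0) =
        (IdeleClassGroup.ideleNorm F (AdeleRing.ideleRelNorm F E (diagUnit (t : borelAdelic F E c 3).2 0)) ^ 2)⁻¹ :=
    fun t => by rw [torusRootModulus_diagUnit_eq_ideleNorm_ideleRelNorm_sq]
  have hnorm : ∀ (k : GaloisRepresentations.principalIdeles F) (y : (AdeleRing (𝓞 F) F)ˣ),
      IdeleClassGroup.ideleNorm F (k • y) = IdeleClassGroup.ideleNorm F y :=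
    ideleNorm_principalIdeles_smul
  have hνm : Measurable fun y : (AdeleRing (𝓞 F) F)ˣ => ((IdeleClassGroup.ideleNorm F y ^ 2)⁻¹ : ℝ≥0) :=
    measurable_ideleNorm_sq_inv
  refine ⟨CG * CP.toNNReal, mul_pos hCG (ENNReal.toNNReal_pos hCP0 hCPt), ?_, ?_⟩
  · -- (L) the `[0, ∞]` bound
    intro β hβ ψ hψm hN hBF Φ hΦm hmaj
    set u : (AdeleRing (𝓞 F) F)ˣ → ℝ≥0∞ := fun y =>
      (((IdeleClassGroup.ideleNorm F y ^ 2)⁻¹ : ℝ≥0) : ℝ≥0∞) * Φ y with hu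
    have hum : Measurable u := (measurable_coe_nnreal_ennreal.comp hνm).mul hΦm
    set uF : (AdeleRing (𝓞 F) F)ˣ → ℝ≥0∞ := fun y =>
      ∑' k : GaloisRepresentations.principalIdeles F, u (k • y) with huF
    have huFm : Measurable uF :=
      Measurable.tsum fun k => hum.comp (measurable_const_mul (k : (AdeleRing (𝓞 F) F)ˣ))
    have huFinv : ∀ k ∈ GaloisRepresentations.principalIdeles F, ∀ y : (AdeleRing (𝓞 F) F)ˣ,
        uF (k * y) = uF y :=
      fun k hk y => tsum_principalIdeles_smul_mul_left u k hk y
    -- the torus integrand is dominated by `uF (N (d₀ t)) * w_T t`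
    have hpt : ∀ t : torusInBorel F E c 3,
        wT t * (((torusRootModulus E 3 (diagUnit (t : borelAdelic F E c 3).2))⁻¹ : ℝ≥0) : ℝ≥0∞) *
            ∫⁻ k, ‖ψ (((t : borelAdelic F E c 3) : (quasiSplit F E c 3).Adelic) *
              (k : (quasiSplit F E c 3).Adelic))‖ₑ ∂μK ≤
          uF (AdeleRing.ideleRelNorm F E (diagUnit (t : borelAdelic F E c 3).2 0)) * wT t := by
      intro t
      have huN : uF (AdeleRing.ideleRelNorm F E (diagUnit (t : borelAdelic F E c 3).2 0)) =
          (((IdeleClassGroup.ideleNorm F (AdeleRing.ideleRelNorm F E (diagUnit (t : borelAdelic F E c 3).2 0)) ^ 2)⁻¹ :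
              ℝ≥0) : ℝ≥0∞) *
            ∑' k : GaloisRepresentations.principalIdeles F,
              Φ (k • AdeleRing.ideleRelNorm F E (diagUnit (t : borelAdelic F E c 3).2 0)) := by
        simp only [huF, hu, hnorm]
        rw [ENNReal.tsum_mul_left]
      rw [huN, hK4 t]
      calc wT t * (((IdeleClassGroup.ideleNorm F
                (AdeleRing.ideleRelNorm F E (diagUnit (t : borelAdelic F E c 3).2 0)) ^ 2)⁻¹ : ℝ≥0) : ℝ≥0∞) *
            ∫⁻ k, ‖ψ (((t : borelAdelic F E c 3) : (quasiSplit F E c 3).Adelic) *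
              (k : (quasiSplit F E c 3).Adelic))‖ₑ ∂μK
          ≤ wT t * (((IdeleClassGroup.ideleNorm F
                (AdeleRing.ideleRelNorm F E (diagUnit (t : borelAdelic F E c 3).2 0)) ^ 2)⁻¹ : ℝ≥0) : ℝ≥0∞) *
            ∑' k : GaloisRepresentations.principalIdeles F,
              Φ (k • AdeleRing.ideleRelNorm F E (diagUnit (t : borelAdelic F E c 3).2 0)) :=
            mul_le_mul_right (hmaj t) _
        _ = _ := by ring
    calc ∫⁻ g, β g * ‖ψ g‖ₑ ∂νG
        = (CG : ℝ≥0∞) * μN Ω * ∫⁻ t : torusInBorel F E c 3,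
            wT t * (((torusRootModulus E 3 (diagUnit (t : borelAdelic F E c 3).2))⁻¹ : ℝ≥0) : ℝ≥0∞) *
              ∫⁻ k, ‖ψ (((t : borelAdelic F E c 3) : (quasiSplit F E c 3).Adelic) *
                (k : (quasiSplit F E c 3).Adelic))‖ₑ ∂μK ∂μT :=
          hL β hβ (fun g => ‖ψ g‖ₑ) hψm.enorm (fun n y => by simp only [hN n y])
            (fun b hb y => by simp only [hBF b hb y])
      _ ≤ (CG : ℝ≥0∞) * μN Ω * ∫⁻ t : torusInBorel F E c 3,
            uF (AdeleRing.ideleRelNorm F E (diagUnit (t : borelAdelic F E c 3).2 0)) * wT t ∂μT :=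
          mul_le_mul_right (lintegral_mono hpt) _
      _ = (CG : ℝ≥0∞) * μN Ω * (CP * ∫⁻ y in 𝓕 ∩ (H : Set (AdeleRing (𝓞 F) F)ˣ), uF y ∂μF) := by
          rw [hP wT hwT' 𝓕 h𝓕 uF huFm huFinv]
      _ = (CG : ℝ≥0∞) * μN Ω * (CP * ∫⁻ y in (H : Set (AdeleRing (𝓞 F) F)ˣ), u y ∂μF) := by
          rw [setLIntegral_inter_tsum_smul_eq_setLIntegral μF h𝓕 hle hHm hum]
      _ = ((CG * CP.toNNReal : ℝ≥0) : ℝ≥0∞) * μN Ω * ∫⁻ y in (H : Set (AdeleRing (𝓞 F) F)ˣ), u y ∂μF := by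
          rw [ENNReal.coe_mul, ENNReal.coe_toNNReal hCPt]; ring
  · -- (B) the Bochner identity
    intro β hβ ψ hψm hN hBF hfin Φ hΦm hK2 hΦH
    obtain ⟨-, hval⟩ := hB β hβ ψ hψm hN hBF hfin
    set Φ' : (AdeleRing (𝓞 F) F)ˣ → ℂ := fun y =>
      (((IdeleClassGroup.ideleNorm F y ^ 2)⁻¹ : ℝ≥0) : ℝ) • Φ y with hΦ'
    have hΦ'm : Measurable Φ' := (measurable_coe_nnreal_real.comp hνm).smul hΦm
    set gF : (AdeleRing (𝓞 F) F)ˣ → ℂ := fun y =>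
      ∑' k : GaloisRepresentations.principalIdeles F, Φ' (k • y) with hgF
    have hgFm : Measurable gF :=
      Measurable.tsum fun k => hΦ'm.comp (measurable_const_mul (k : (AdeleRing (𝓞 F) F)ˣ))
    have hgFinv : ∀ k ∈ GaloisRepresentations.principalIdeles F, ∀ y : (AdeleRing (𝓞 F) F)ˣ,
        gF (k * y) = gF y :=
      fun k hk y => tsum_principalIdeles_smul_mul_left Φ' k hk y
    -- finiteness over `𝓕 ∩ H` from `Φ' ∈ L¹(H)`
    have hgFfin : ∫⁻ y in 𝓕 ∩ (H : Set (AdeleRing (𝓞 F) F)ˣ), ‖gF y‖ₑ ∂μF < ∞ := by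
      refine lt_of_le_of_lt (lintegral_mono fun y => enorm_tsum_le_tsum_enorm) ?_
      rw [setLIntegral_inter_tsum_enorm_smul_eq μF h𝓕 hle hHm hΦ'm.aestronglyMeasurable]
      exact hΦH.2
    obtain ⟨-, -, hpush⟩ := hPB wT hwT' 𝓕 h𝓕 gF hgFm hgFinv hgFfin
    rw [setIntegral_inter_tsum_smul_eq_setIntegral μF h𝓕 hle hHm hΦH] at hpush
    -- the torus integrand of ★ (C-G) (B) is `(w_T t).toReal • gF (N (d₀ t))`
    have hpt : ∀ t : torusInBorel F E c 3,
        ((wT t).toReal * ((torusRootModulus E 3 (diagUnit (t : borelAdelic F E c 3).2) : ℝ≥0) : ℝ)⁻¹) •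
            ∫ k, ψ (((t : borelAdelic F E c 3) : (quasiSplit F E c 3).Adelic) *
              (k : (quasiSplit F E c 3).Adelic)) ∂μK =
          (wT t).toReal • gF (AdeleRing.ideleRelNorm F E (diagUnit (t : borelAdelic F E c 3).2 0)) := by
      intro t
      rw [hK2 t, mul_smul, ← NNReal.coe_inv, hK4 t]
      congr 1
      simp only [hgF, hΦ', hnorm]
      rw [tsum_const_smul'']
    refine ⟨integrable_toReal_smul_of_lintegral_lt_top hβ.measurable hψm hfin, ?_⟩
    rw [hval]
    simp_rw [hpt]
    rw [hpush, NNReal.coe_mul, Complex.ofReal_mul, ENNReal.coe_toNNReal_eq_toReal]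
    ring

end Assembly

/-! ## §2 At the centre lattice sum `ψᶜ_f(g) = Σ'_{w ∈ E⁻ ∖ 0} f(g⁻¹ z₁ n(w) g)` -/

section CentrePart

variable [Algebra.IsQuadraticExtension F E]
  [MeasurableSpace (quasiSplit F E c 3).Adelic] [BorelSpace (quasiSplit F E c 3).Adelic]
  [MeasurableSpace (AdeleRing (𝓞 F) F)ˣ] [BorelSpace (AdeleRing (𝓞 F) F)ˣ]
  (ζ : ratOne F E c) {z₁ : (quasiSplit F E c 3).arithmeticSubgroup}

omit [MeasurableSpace (AdeleRing (𝓞 F) F)ˣ] [BorelSpace (AdeleRing (𝓞 F) F)ˣ] in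
/-- **THE TORUS `K`-AVERAGE OF `‖ψᶜ_f‖` IS DOMINATED BY THE LATTICE SUM OF THE ABSOLUTE CENTRE PROFILE**: for
`t ∈ T(𝔸)`, `∫⁻_{K_U} ‖ψᶜ_f(t k)‖ dμ_K ≤ Σ_{κ ∈ F^*} Φ⁺_f(κ · N(d₀ t))` with
`Φ⁺_f(y) = ∫⁻_{K_U} ‖f(k⁻¹ z₁ n(θ(y⁻¹)) k)‖ dμ_K` (`‖Σ'‖ ≤ Σ'‖·‖`, ★ `tsum_centre_conj_torus_mul_eq_tsum_principalIdeles`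
at `G = ‖f ·‖`, Tonelli) — Rogawski's «`M` acts on `n(w)` through `α₃(m)⁻¹`», `{w ≠ 0} = θ(F^*)`.
[cite: Rogawski1990, §7.3 (7.3.2) (p. 96)] [cite: Rogawski1990, §7.2 (p. 94)] -/
theorem lintegral_enorm_centrePart_torus_mul_le (hc : c * c = 1) {δ : E} (hcδ : c δ = -δ) (hδ : δ ≠ 0)
    (hz₁ : (z₁ : (quasiSplit F E c 3).Adelic) =
      (quasiSplit F E c 3).toAdelic (ratCenter F E c 3 ((StdForm.antidiagonal 3).over E) ζ))
    (μK : Measure ((standardMaximalCompactGL 3 E).comap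
      (adelicVal F E c 3 ((StdForm.antidiagonal 3).over E)) : Subgroup (quasiSplit F E c 3).Adelic))
    {f : (quasiSplit F E c 3).Adelic → ℂ} (hfc : Continuous f) (t : torusInBorel F E c 3) :
    ∫⁻ k, ‖∑' w : {w : rationalTraceZero F E c // w ≠ 0},
        f ((((t : borelAdelic F E c 3) : (quasiSplit F E c 3).Adelic) * (k : (quasiSplit F E c 3).Adelic))⁻¹ *
          ((z₁ : (quasiSplit F E c 3).Adelic) *
            (((heisChart hc ((0 : AdeleRing (𝓞 E) E), ((w.1 : rationalTraceZero F E c) : traceZeroAdele F E c))) :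
              adelicUnipotent F E c 3) : (quasiSplit F E c 3).Adelic)) *
          (((t : borelAdelic F E c 3) : (quasiSplit F E c 3).Adelic) * (k : (quasiSplit F E c 3).Adelic)))‖ₑ ∂μK ≤
      ∑' κ : GaloisRepresentations.principalIdeles F,
        ∫⁻ k, ‖f ((k : (quasiSplit F E c 3).Adelic)⁻¹ * ((z₁ : (quasiSplit F E c 3).Adelic) *
          ((heisChart hc ((0 : AdeleRing (𝓞 E) E),
              traceZeroLine F E c hcδ hδ
                (((κ • AdeleRing.ideleRelNorm F E (diagUnit (t : borelAdelic F E c 3).2 0))⁻¹ :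
                  (AdeleRing (𝓞 F) F)ˣ) : AdeleRing (𝓞 F) F)) :
            adelicUnipotent F E c 3) : (quasiSplit F E c 3).Adelic)) * (k : (quasiSplit F E c 3).Adelic))‖ₑ ∂μK := by
  haveI : BorelSpace ((standardMaximalCompactGL 3 E).comap
      (adelicVal F E c 3 ((StdForm.antidiagonal 3).over E)) : Subgroup (quasiSplit F E c 3).Adelic) :=
    Subtype.borelSpace _
  calc ∫⁻ k, ‖∑' w : {w : rationalTraceZero F E c // w ≠ 0},
        f ((((t : borelAdelic F E c 3) : (quasiSplit F E c 3).Adelic) * (k : (quasiSplit F E c 3).Adelic))⁻¹ *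
          ((z₁ : (quasiSplit F E c 3).Adelic) *
            (((heisChart hc ((0 : AdeleRing (𝓞 E) E), ((w.1 : rationalTraceZero F E c) : traceZeroAdele F E c))) :
              adelicUnipotent F E c 3) : (quasiSplit F E c 3).Adelic)) *
          (((t : borelAdelic F E c 3) : (quasiSplit F E c 3).Adelic) * (k : (quasiSplit F E c 3).Adelic)))‖ₑ ∂μK
      ≤ ∫⁻ k, ∑' w : {w : rationalTraceZero F E c // w ≠ 0},
        ‖f ((((t : borelAdelic F E c 3) : (quasiSplit F E c 3).Adelic) * (k : (quasiSplit F E c 3).Adelic))⁻¹ *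
          ((z₁ : (quasiSplit F E c 3).Adelic) *
            (((heisChart hc ((0 : AdeleRing (𝓞 E) E), ((w.1 : rationalTraceZero F E c) : traceZeroAdele F E c))) :
              adelicUnipotent F E c 3) : (quasiSplit F E c 3).Adelic)) *
          (((t : borelAdelic F E c 3) : (quasiSplit F E c 3).Adelic) * (k : (quasiSplit F E c 3).Adelic)))‖ₑ ∂μK :=
        lintegral_mono fun k => enorm_tsum_le_tsum_enorm
    _ = ∫⁻ k, ∑' κ : GaloisRepresentations.principalIdeles F,
        ‖f ((k : (quasiSplit F E c 3).Adelic)⁻¹ * ((z₁ : (quasiSplit F E c 3).Adelic) *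
          ((heisChart hc ((0 : AdeleRing (𝓞 E) E),
              traceZeroLine F E c hcδ hδ
                (((κ • AdeleRing.ideleRelNorm F E (diagUnit (t : borelAdelic F E c 3).2 0))⁻¹ :
                  (AdeleRing (𝓞 F) F)ˣ) : AdeleRing (𝓞 F) F)) :
            adelicUnipotent F E c 3) : (quasiSplit F E c 3).Adelic)) * (k : (quasiSplit F E c 3).Adelic))‖ₑ ∂μK :=
        lintegral_congr fun k =>
          tsum_centre_conj_torus_mul_eq_tsum_principalIdeles ζ hc hcδ hδ hz₁ (fun x => ‖f x‖ₑ) t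
            (k : (quasiSplit F E c 3).Adelic)
    _ = _ := lintegral_tsum fun κ =>
        ((hfc.comp (((continuous_subtype_val.inv).mul continuous_const).mul
          continuous_subtype_val)).measurable.enorm).aemeasurable

/-- **The absolute centre profile `Φ⁺_f(y) = ∫⁻_{K_U} ‖f(k⁻¹ z₁ n(θ(y⁻¹)) k)‖ dμ_K` is Borel on `𝕀_F`** (joint continuity
of `(y, k) ↦ f(k⁻¹ z₁ n(θ(y⁻¹)) k)`, Tonelli measurability). [cite: Rogawski1990, §7.3 (p. 96)] -/
theorem measurable_lintegral_enorm_centreProfile (hc : c * c = 1) {δ : E} (hcδ : c δ = -δ) (hδ : δ ≠ 0)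
    (μK : Measure ((standardMaximalCompactGL 3 E).comap
      (adelicVal F E c 3 ((StdForm.antidiagonal 3).over E)) : Subgroup (quasiSplit F E c 3).Adelic))
    [μK.IsHaarMeasure] {f : (quasiSplit F E c 3).Adelic → ℂ} (hfc : Continuous f) :
    Measurable fun y : (AdeleRing (𝓞 F) F)ˣ =>
      ∫⁻ k, ‖f ((k : (quasiSplit F E c 3).Adelic)⁻¹ * ((z₁ : (quasiSplit F E c 3).Adelic) *
        ((heisChart hc ((0 : AdeleRing (𝓞 E) E),
            traceZeroLine F E c hcδ hδ (((y⁻¹ : (AdeleRing (𝓞 F) F)ˣ)) : AdeleRing (𝓞 F) F)) :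
          adelicUnipotent F E c 3) : (quasiSplit F E c 3).Adelic)) * (k : (quasiSplit F E c 3).Adelic))‖ₑ ∂μK := by
  haveI := secondCountableTopology_ideleGroup F
  have hKc : IsCompact (((standardMaximalCompactGL 3 E).comap (adelicVal F E c 3 ((StdForm.antidiagonal 3).over E)) :
      Subgroup (quasiSplit F E c 3).Adelic) : Set (quasiSplit F E c 3).Adelic) :=
    isCompact_comap_adelicVal_standardMaximalCompactGL
  haveI : CompactSpace ((standardMaximalCompactGL 3 E).comap (adelicVal F E c 3 ((StdForm.antidiagonal 3).over E)) :
      Subgroup (quasiSplit F E c 3).Adelic) := isCompact_iff_compactSpace.1 hKc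
  haveI : BorelSpace ((standardMaximalCompactGL 3 E).comap
      (adelicVal F E c 3 ((StdForm.antidiagonal 3).over E)) : Subgroup (quasiSplit F E c 3).Adelic) :=
    Subtype.borelSpace _
  haveI : IsFiniteMeasure μK := CompactSpace.isFiniteMeasure
  have hcont : Continuous fun p : (AdeleRing (𝓞 F) F)ˣ × ((standardMaximalCompactGL 3 E).comap
      (adelicVal F E c 3 ((StdForm.antidiagonal 3).over E)) : Subgroup (quasiSplit F E c 3).Adelic) =>
      f ((p.2 : (quasiSplit F E c 3).Adelic)⁻¹ * ((z₁ : (quasiSplit F E c 3).Adelic) *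
        ((heisChart hc ((0 : AdeleRing (𝓞 E) E),
            traceZeroLine F E c hcδ hδ (((p.1⁻¹ : (AdeleRing (𝓞 F) F)ˣ)) : AdeleRing (𝓞 F) F)) :
          adelicUnipotent F E c 3) : (quasiSplit F E c 3).Adelic)) * (p.2 : (quasiSplit F E c 3).Adelic)) := by
    refine hfc.comp ((((continuous_subtype_val.comp continuous_snd).inv).mul
      (continuous_const.mul (continuous_subtype_val.comp ((heisChart hc).continuous.comp
        (continuous_const.prodMk ((traceZeroLine F E c hcδ hδ).continuous.comp
          (Units.continuous_val.comp (continuous_inv.comp continuous_fst)))))))).mul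
      (continuous_subtype_val.comp continuous_snd))
  exact hcont.measurable.enorm.lintegral_prod_right'

/-- **`hCfin` — THE WEIGHTED `[0, ∞]`-INTEGRAL OF THE CENTRE LATTICE SUM IS FINITE from the idele side.** In the
letters of ★ `exists_lintegral_le_and_integral_eq_of_torus_kAverage` and ★ B1 (`z₁ = ι(ratCenter ζ)`), for
`f : G(𝔸) → ℂ` continuous, a covering weight `β` of `B(F)♯`, `μ_N(Ω) < ∞`, and the idele-side finiteness
`∫⁻_{y ∈ H} (‖y‖²)⁻¹ Φ⁺_f(y) dμ_F < ∞` (Tate's absolute convergence at `s = 2` for the `K`-averaged centre orbital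
function): **`∫⁻ β(g) ‖Σ'_{w ≠ 0} f(g⁻¹ z₁ n(w) g)‖ dν_G(g) < ∞`** — the hypothesis `hCfin` of ★
`exists_heisPart_integral_eq_torus` VERBATIM. (★ §1 (L) at `ψ = ψᶜ_f`: Borel ★ `measurable_centrePart`, left-`N(𝔸)`-invariant
★ `tsum_centre_conj_unipotent_mul`, left-`B(F)`-invariant ★ `tsum_centre_conj_borel_mul`, dominated ★
`lintegral_enorm_centrePart_torus_mul_le`.) [cite: Rogawski1990, §7.3 (7.3.2) and Prop. 7.3.2 (c), (d) (pp. 96–97)]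
[cite: Arthur1981TraceFormulaInvariantForm, §2] -/
theorem lintegral_weight_mul_enorm_centrePart_lt_top (hc : c * c = 1) (hc1 : c ≠ 1)
    {δ : E} (hcδ : c δ = -δ) (hδ : δ ≠ 0) (θ : 𝓞 F) (hθ : θ ≠ 0) (hd : δ * δ = algebraMap F E (θ : F))
    (hz₁ : (z₁ : (quasiSplit F E c 3).Adelic) =
      (quasiSplit F E c 3).toAdelic (ratCenter F E c 3 ((StdForm.antidiagonal 3).over E) ζ))
    (νG : Measure (quasiSplit F E c 3).Adelic) [νG.IsHaarMeasure]
    (μB : Measure (borelAdelic F E c 3)) [μB.IsHaarMeasure]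
    (μK : Measure ((standardMaximalCompactGL 3 E).comap
      (adelicVal F E c 3 ((StdForm.antidiagonal 3).over E)) : Subgroup (quasiSplit F E c 3).Adelic))
    [μK.IsHaarMeasure]
    (μT : Measure (torusInBorel F E c 3)) [μT.IsHaarMeasure]
    (μN : Measure (unipotentInBorel F E c 3)) [μN.IsHaarMeasure]
    (hBK : ∀ g : (quasiSplit F E c 3).Adelic, ∃ b ∈ borelAdelic F E c 3, ∃ k : (quasiSplit F E c 3).Adelic,
      adelicVal F E c 3 ((StdForm.antidiagonal 3).over E) k ∈ standardMaximalCompactGL 3 E ∧ g = b * k)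
    {Ω : Set (unipotentInBorel F E c 3)} (hΩ : MeasurableSet Ω)
    (hΩu : ∀ n : unipotentInBorel F E c 3,
      ∃! ν : (((quasiSplit F E c 3).arithmeticSubgroup).subgroupOf (borelAdelic F E c 3)).subgroupOf
        (unipotentInBorel F E c 3), ν • n ∈ Ω)
    (hΩfin : μN Ω ≠ ∞)
    {wT : torusInBorel F E c 3 → ℝ≥0∞}
    (hwT : IsCoveringWeight ((((quasiSplit F E c 3).arithmeticSubgroup).subgroupOf (borelAdelic F E c 3)).subgroupOf
      (torusInBorel F E c 3)) wT)
    (μF : Measure (AdeleRing (𝓞 F) F)ˣ) [IsHaarMeasure μF]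
    {f : (quasiSplit F E c 3).Adelic → ℂ} (hfc : Continuous f)
    {β : (quasiSplit F E c 3).Adelic → ℝ≥0∞}
    (hβ : IsCoveringWeight ((arithmeticBorel F E c 3).map (quasiSplit F E c 3).arithmeticSubgroup.subtype) β)
    (hHfin : ∫⁻ y in ↑(GaloisRepresentations.principalIdeles F ⊔ normIdeles F (θ : F)),
      (((IdeleClassGroup.ideleNorm F y ^ 2)⁻¹ : ℝ≥0) : ℝ≥0∞) *
        ∫⁻ k, ‖f ((k : (quasiSplit F E c 3).Adelic)⁻¹ * ((z₁ : (quasiSplit F E c 3).Adelic) *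
          ((heisChart hc ((0 : AdeleRing (𝓞 E) E),
              traceZeroLine F E c hcδ hδ (((y⁻¹ : (AdeleRing (𝓞 F) F)ˣ)) : AdeleRing (𝓞 F) F)) :
            adelicUnipotent F E c 3) : (quasiSplit F E c 3).Adelic)) * (k : (quasiSplit F E c 3).Adelic))‖ₑ ∂μK ∂μF < ∞) :
    ∫⁻ g, β g * ‖∑' w : {w : rationalTraceZero F E c // w ≠ 0},
        f (g⁻¹ * ((z₁ : (quasiSplit F E c 3).Adelic) *
          (((heisChart hc ((0 : AdeleRing (𝓞 E) E), ((w.1 : rationalTraceZero F E c) : traceZeroAdele F E c))) :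
            adelicUnipotent F E c 3) : (quasiSplit F E c 3).Adelic)) * g)‖ₑ ∂νG < ∞ := by
  obtain ⟨C, -, hL, -⟩ := exists_lintegral_le_and_integral_eq_of_torus_kAverage hc hc1 hcδ hδ θ hθ hd νG μB μK μT μN
    hBK hΩ hΩu hwT μF
  refine lt_of_le_of_lt (hL β hβ _ (measurable_centrePart (z₁ := z₁) hc hfc)
    (fun n y => tsum_centre_conj_unipotent_mul ζ hc hz₁ f n y)
    (fun b hb y => tsum_centre_conj_borel_mul ζ hc hz₁ f b hb y) _
    (measurable_lintegral_enorm_centreProfile (z₁ := z₁) hc hcδ hδ μK hfc)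
    (fun t => lintegral_enorm_centrePart_torus_mul_le ζ hc hcδ hδ hz₁ μK hfc t)) ?_
  exact ENNReal.mul_lt_top (ENNReal.mul_lt_top ENNReal.coe_lt_top hΩfin.lt_top) hHfin

end CentrePart

/-! ## §3 `(hCfin, hCi, hCv)` UNCONDITIONAL for a test function `f ∈ C_c(G(𝔸))` -/

section TestFunction

variable [Algebra.IsQuadraticExtension F E]
  [MeasurableSpace (quasiSplit F E c 3).Adelic] [BorelSpace (quasiSplit F E c 3).Adelic]
  [MeasurableSpace (AdeleRing (𝓞 F) F)ˣ] [BorelSpace (AdeleRing (𝓞 F) F)ˣ]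
  (ζ : ratOne F E c) {z₁ : (quasiSplit F E c 3).arithmeticSubgroup}

/-- **`hCfin` UNCONDITIONAL — `∫⁻ β(g) ‖Σ'_{w ≠ 0} f(g⁻¹ z₁ n(w) g)‖ dν_G(g) < ∞` for `f ∈ C_c(G(𝔸))`**, a covering
weight `β` of `B(F)♯` and `μ_N(Ω) < ∞`: ★ `lintegral_weight_mul_enorm_centrePart_lt_top` with its idele-side input
discharged by ★ (C-γ-fin) `setLIntegral_ideleNorm_sq_inv_mul_centreProfile_lt_top` (Tate's absolute convergence at
`s = 2` for the compactly supported `K`-averaged centre profile). The hypothesis `hCfin` of ★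
`exists_heisPart_integral_eq_torus` VERBATIM. [cite: Rogawski1990, §7.3 (7.3.2) and Prop. 7.3.2 (c), (d) (pp. 96–97)]
[cite: Arthur1981TraceFormulaInvariantForm, §2] -/
theorem lintegral_weight_mul_enorm_centrePart_lt_top_of_hasCompactSupport (hc : c * c = 1) (hc1 : c ≠ 1)
    {δ : E} (hcδ : c δ = -δ) (hδ : δ ≠ 0) (θ : 𝓞 F) (hθ : θ ≠ 0) (hd : δ * δ = algebraMap F E (θ : F))
    (hz₁ : (z₁ : (quasiSplit F E c 3).Adelic) =
      (quasiSplit F E c 3).toAdelic (ratCenter F E c 3 ((StdForm.antidiagonal 3).over E) ζ))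
    (νG : Measure (quasiSplit F E c 3).Adelic) [νG.IsHaarMeasure]
    (μB : Measure (borelAdelic F E c 3)) [μB.IsHaarMeasure]
    (μK : Measure ((standardMaximalCompactGL 3 E).comap
      (adelicVal F E c 3 ((StdForm.antidiagonal 3).over E)) : Subgroup (quasiSplit F E c 3).Adelic))
    [μK.IsHaarMeasure]
    (μT : Measure (torusInBorel F E c 3)) [μT.IsHaarMeasure]
    (μN : Measure (unipotentInBorel F E c 3)) [μN.IsHaarMeasure]
    (hBK : ∀ g : (quasiSplit F E c 3).Adelic, ∃ b ∈ borelAdelic F E c 3, ∃ k : (quasiSplit F E c 3).Adelic,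
      adelicVal F E c 3 ((StdForm.antidiagonal 3).over E) k ∈ standardMaximalCompactGL 3 E ∧ g = b * k)
    {Ω : Set (unipotentInBorel F E c 3)} (hΩ : MeasurableSet Ω)
    (hΩu : ∀ n : unipotentInBorel F E c 3,
      ∃! ν : (((quasiSplit F E c 3).arithmeticSubgroup).subgroupOf (borelAdelic F E c 3)).subgroupOf
        (unipotentInBorel F E c 3), ν • n ∈ Ω)
    (hΩfin : μN Ω ≠ ∞)
    {wT : torusInBorel F E c 3 → ℝ≥0∞}
    (hwT : IsCoveringWeight ((((quasiSplit F E c 3).arithmeticSubgroup).subgroupOf (borelAdelic F E c 3)).subgroupOf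
      (torusInBorel F E c 3)) wT)
    (μF : Measure (AdeleRing (𝓞 F) F)ˣ) [IsHaarMeasure μF]
    {f : (quasiSplit F E c 3).Adelic → ℂ} (hfc : Continuous f) (hf : HasCompactSupport f)
    {β : (quasiSplit F E c 3).Adelic → ℝ≥0∞}
    (hβ : IsCoveringWeight ((arithmeticBorel F E c 3).map (quasiSplit F E c 3).arithmeticSubgroup.subtype) β) :
    ∫⁻ g, β g * ‖∑' w : {w : rationalTraceZero F E c // w ≠ 0},
        f (g⁻¹ * ((z₁ : (quasiSplit F E c 3).Adelic) *
          (((heisChart hc ((0 : AdeleRing (𝓞 E) E), ((w.1 : rationalTraceZero F E c) : traceZeroAdele F E c))) :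
            adelicUnipotent F E c 3) : (quasiSplit F E c 3).Adelic)) * g)‖ₑ ∂νG < ∞ :=
  lintegral_weight_mul_enorm_centrePart_lt_top ζ hc hc1 hcδ hδ θ hθ hd hz₁ νG μB μK μT μN hBK hΩ hΩu hΩfin hwT μF hfc hβ
    (setLIntegral_ideleNorm_sq_inv_mul_centreProfile_lt_top hc hcδ hδ (z₁ : (quasiSplit F E c 3).Adelic) μK μF hfc hf _)

/-- **`(hCi, hCv)` — THE CENTRE-LATTICE PART OF THE UNIPOTENT TERM, EVALUATED** [Rogawski1990, Prop. 7.3.2 (c)+(d) with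
(7.3.2)]: for the quasi-split `U(J₃)` of a quadratic `E = F(δ)/F` and the data of ★
`exists_lintegral_le_and_integral_eq_of_torus_kAverage`, there is ONE constant `C > 0` such that for every
`z₁ = ι(ratCenter ζ)`, every test function `f ∈ C_c(G(𝔸))`, every covering weight `β` of `B(F)♯`, provided
`μ_N(Ω) < ∞`: `g ↦ (β g).toReal • Σ'_{w ∈ E⁻ ∖ 0} f(g⁻¹ z₁ n(w) g)` is `ν_G`-integrable and

  **`∫ β(g) • Σ'_{w ≠ 0} f(g⁻¹ z₁ n(w) g) dν_G(g) = C · μ_N(Ω) · ∫_{y ∈ F^*·N(I_E)} (‖y‖²)⁻¹ • Φ_f(y) dμ_F(y)`**,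
  `Φ_f(y) = ∫_{K_U} f(k⁻¹ z₁ n(θ(y⁻¹)) k) dμ_K` the norm profile (★ (C-K) `measurable_centreProfile`)

— i.e. the hypotheses `(hCi, hCv)` of ★ (F) `truncatedTraceClass_central_eq_linear_of_parts` at
`Cc := C · μ_N(Ω) · ∫_{H} (‖y‖²)⁻¹ • Φ_f`. (★ §1 (B) at `ψ = ψᶜ_f`, `Φ = Φ_f`: the torus `K`-average ★ (C-K)
`integral_tsum_centre_torus_mul_eq_tsum_principalIdeles`, finiteness ★ `lintegral_weight_mul_enorm_centrePart_lt_top_of_hasCompactSupport`,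
`(‖·‖²)⁻¹ • Φ_f ∈ L¹(H)` ★ (C-γ-fin) `integrableOn_ideleNorm_sq_inv_smul_centreProfile`.)
[cite: Rogawski1990, §7.3 (7.3.2) and Prop. 7.3.2 (c), (d) (pp. 96–97)] [cite: Arthur1981TraceFormulaInvariantForm, §2] -/
theorem exists_integrable_and_integral_weight_smul_centrePart_eq (hc : c * c = 1) (hc1 : c ≠ 1)
    {δ : E} (hcδ : c δ = -δ) (hδ : δ ≠ 0) (θ : 𝓞 F) (hθ : θ ≠ 0) (hd : δ * δ = algebraMap F E (θ : F))
    (νG : Measure (quasiSplit F E c 3).Adelic) [νG.IsHaarMeasure]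
    (μB : Measure (borelAdelic F E c 3)) [μB.IsHaarMeasure]
    (μK : Measure ((standardMaximalCompactGL 3 E).comap
      (adelicVal F E c 3 ((StdForm.antidiagonal 3).over E)) : Subgroup (quasiSplit F E c 3).Adelic))
    [μK.IsHaarMeasure]
    (μT : Measure (torusInBorel F E c 3)) [μT.IsHaarMeasure]
    (μN : Measure (unipotentInBorel F E c 3)) [μN.IsHaarMeasure]
    (hBK : ∀ g : (quasiSplit F E c 3).Adelic, ∃ b ∈ borelAdelic F E c 3, ∃ k : (quasiSplit F E c 3).Adelic,
      adelicVal F E c 3 ((StdForm.antidiagonal 3).over E) k ∈ standardMaximalCompactGL 3 E ∧ g = b * k)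
    {Ω : Set (unipotentInBorel F E c 3)} (hΩ : MeasurableSet Ω)
    (hΩu : ∀ n : unipotentInBorel F E c 3,
      ∃! ν : (((quasiSplit F E c 3).arithmeticSubgroup).subgroupOf (borelAdelic F E c 3)).subgroupOf
        (unipotentInBorel F E c 3), ν • n ∈ Ω)
    (hΩfin : μN Ω ≠ ∞)
    {wT : torusInBorel F E c 3 → ℝ≥0∞}
    (hwT : IsCoveringWeight ((((quasiSplit F E c 3).arithmeticSubgroup).subgroupOf (borelAdelic F E c 3)).subgroupOf
      (torusInBorel F E c 3)) wT)
    (μF : Measure (AdeleRing (𝓞 F) F)ˣ) [IsHaarMeasure μF] :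
    ∃ C : ℝ≥0, 0 < C ∧
      ∀ (ζ : ratOne F E c) {z₁ : (quasiSplit F E c 3).arithmeticSubgroup},
        (z₁ : (quasiSplit F E c 3).Adelic) =
          (quasiSplit F E c 3).toAdelic (ratCenter F E c 3 ((StdForm.antidiagonal 3).over E) ζ) →
      ∀ {f : (quasiSplit F E c 3).Adelic → ℂ}, Continuous f → HasCompactSupport f →
      ∀ {β : (quasiSplit F E c 3).Adelic → ℝ≥0∞},
        IsCoveringWeight ((arithmeticBorel F E c 3).map (quasiSplit F E c 3).arithmeticSubgroup.subtype) β →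
        Integrable (fun g : (quasiSplit F E c 3).Adelic => (β g).toReal •
          ∑' w : {w : rationalTraceZero F E c // w ≠ 0},
            f (g⁻¹ * ((z₁ : (quasiSplit F E c 3).Adelic) *
              (((heisChart hc ((0 : AdeleRing (𝓞 E) E), ((w.1 : rationalTraceZero F E c) : traceZeroAdele F E c))) :
                adelicUnipotent F E c 3) : (quasiSplit F E c 3).Adelic)) * g)) νG ∧
        ∫ g, (β g).toReal •
          ∑' w : {w : rationalTraceZero F E c // w ≠ 0},
            f (g⁻¹ * ((z₁ : (quasiSplit F E c 3).Adelic) *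
              (((heisChart hc ((0 : AdeleRing (𝓞 E) E), ((w.1 : rationalTraceZero F E c) : traceZeroAdele F E c))) :
                adelicUnipotent F E c 3) : (quasiSplit F E c 3).Adelic)) * g) ∂νG =
          ((C : ℝ) : ℂ) * (μN.real Ω : ℂ) *
            ∫ y in ↑(GaloisRepresentations.principalIdeles F ⊔ normIdeles F (θ : F)),
              (((IdeleClassGroup.ideleNorm F y ^ 2)⁻¹ : ℝ≥0) : ℝ) •
                ∫ k, f ((k : (quasiSplit F E c 3).Adelic)⁻¹ * ((z₁ : (quasiSplit F E c 3).Adelic) *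
                  ((heisChart hc ((0 : AdeleRing (𝓞 E) E),
                      traceZeroLine F E c hcδ hδ (((y⁻¹ : (AdeleRing (𝓞 F) F)ˣ)) : AdeleRing (𝓞 F) F)) :
                    adelicUnipotent F E c 3) : (quasiSplit F E c 3).Adelic)) * (k : (quasiSplit F E c 3).Adelic)) ∂μK
              ∂μF := by
  obtain ⟨C, hC, -, hB⟩ := exists_lintegral_le_and_integral_eq_of_torus_kAverage hc hc1 hcδ hδ θ hθ hd νG μB μK μT μN
    hBK hΩ hΩu hwT μF
  refine ⟨C, hC, fun ζ z₁ hz₁ f hfc hf β hβ => ?_⟩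
  exact hB β hβ _ (measurable_centrePart (z₁ := z₁) hc hfc)
    (fun n y => tsum_centre_conj_unipotent_mul ζ hc hz₁ f n y)
    (fun b hb y => tsum_centre_conj_borel_mul ζ hc hz₁ f b hb y)
    (lintegral_weight_mul_enorm_centrePart_lt_top_of_hasCompactSupport ζ hc hc1 hcδ hδ θ hθ hd hz₁ νG μB μK μT μN hBK
      hΩ hΩu hΩfin hwT μF hfc hf hβ)
    _ (measurable_centreProfile μK hc hcδ hδ z₁ hfc)
    (fun t => integral_tsum_centre_torus_mul_eq_tsum_principalIdeles ζ μK hc hcδ hδ hz₁ hf hfc t _ fun _ => rfl)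
    (integrableOn_ideleNorm_sq_inv_smul_centreProfile hc hcδ hδ (z₁ : (quasiSplit F E c 3).Adelic) μK μF hfc hf _)

end TestFunction

/-! ## §4 Presentation: the index-two split `∫_H = ½ Σ_{χ ∈ {1, ω}} ∫ χ` and the flip `y ↦ y⁻¹` (ED. 2) -/

section IndexTwo

variable [MeasurableSpace (AdeleRing (𝓞 F) F)ˣ] [BorelSpace (AdeleRing (𝓞 F) F)ˣ]

/-- **`∫_{F^*·N(I_E)} g = ½ ∫ g + ½ ∫ g·ω`** for `g ∈ L¹(𝕀_F)` and the quadratic character `ω = (−1)^{[·]}` of the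
norm classes `H = F^* ⊔ N(I_E)` of `E = F(√d)` (★ `setIntegral_eq_half_add_half_mul_of_integrable`, `ω = 1` on `H` and
`= −1` off `H` ★ `neg_one_pow_quadraticArtinIndicator_of_mem` ∕ `_of_not_mem`) — Rogawski's `½ m Σ_χ ∫_{I_F} … χ(t) …`,
`χ ∈ {1, ω_{E/F}}`. [cite: Rogawski1990, §7.3 Prop. 7.3.2 (c), (d) (p. 96)] [cite: Omeara1963, §71 Thm. 71:19] -/
theorem setIntegral_normClasses_eq_half_add_half_integral_mul_quadraticChar (d : F)
    (μF : Measure (AdeleRing (𝓞 F) F)ˣ) {g : (AdeleRing (𝓞 F) F)ˣ → ℂ} (hg : Integrable g μF) :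
    ∫ y in ↑(GaloisRepresentations.principalIdeles F ⊔ normIdeles F d), g y ∂μF =
      (1 / 2 : ℂ) * ∫ y, g y ∂μF +
        (1 / 2 : ℂ) * ∫ y, g y * (-1 : ℂ) ^ (GaloisRepresentations.quadraticArtinIndicator F d y).val ∂μF :=
  setIntegral_eq_half_add_half_mul_of_integrable μF
    (GaloisRepresentations.measurableSet_principalIdeles_sup_normIdeles (K := F) d) _
    (fun _ hy => GaloisRepresentations.neg_one_pow_quadraticArtinIndicator_of_mem hy)
    (fun _ hy => GaloisRepresentations.neg_one_pow_quadraticArtinIndicator_of_not_mem hy) hg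

omit [MeasurableSpace (AdeleRing (𝓞 F) F)ˣ] [BorelSpace (AdeleRing (𝓞 F) F)ˣ] in
/-- `‖y⁻¹‖ = ‖y‖⁻¹` for the idele norm `IdeleClassGroup.ideleNorm` (a homomorphism to `ℝ_{>0}`).
[cite: WeilBNT1967, Ch. IV §4 Thm. 5] -/
theorem ideleClassGroup_ideleNorm_inv (y : (AdeleRing (𝓞 F) F)ˣ) :
    IdeleClassGroup.ideleNorm F y⁻¹ = (IdeleClassGroup.ideleNorm F y)⁻¹ := by
  refine eq_inv_of_mul_eq_one_left ?_
  rw [← map_mul, inv_mul_cancel, map_one]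

/-- **THE FLIP `y ↦ y⁻¹`: `∫ (‖y‖²)⁻¹ • Ψ(y⁻¹) dμ_F = ∫ ‖y‖² • Ψ(y) dμ_F`** for a Haar measure of the (commutative) idele
group and any `Ψ` (★ `integral_comp_inv_eq`; `‖y⁻¹‖ = ‖y‖⁻¹`) — turns the norm profile `Φ_f(y) = Ψ_f(y⁻¹)` of §3 into
Rogawski's `f^K(z n(tδ₀)) ‖t‖²`. [cite: Rogawski1990, §7.3 (7.3.2) (p. 96)] [cite: Folland1995, §2.6 Thm. 2.49] -/
theorem integral_ideleNorm_sq_inv_smul_comp_inv_eq {V : Type*} [NormedAddCommGroup V] [NormedSpace ℝ V]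
    (μF : Measure (AdeleRing (𝓞 F) F)ˣ) [IsHaarMeasure μF] (Ψ : (AdeleRing (𝓞 F) F)ˣ → V) :
    ∫ y, (((IdeleClassGroup.ideleNorm F y ^ 2)⁻¹ : ℝ≥0) : ℝ) • Ψ y⁻¹ ∂μF =
      ∫ y, ((IdeleClassGroup.ideleNorm F y ^ 2 : ℝ≥0) : ℝ) • Ψ y ∂μF := by
  rw [← integral_comp_inv_eq μF (fun y => ((IdeleClassGroup.ideleNorm F y ^ 2 : ℝ≥0) : ℝ) • Ψ y)]
  refine integral_congr_ae (ae_of_all _ fun y => ?_)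
  simp only [ideleClassGroup_ideleNorm_inv, inv_pow]

/-- The same flip against the quadratic character: `∫ ((‖y‖²)⁻¹ • Ψ(y⁻¹)) ω(y) dμ_F = ∫ (‖y‖² • Ψ(y)) ω(y) dμ_F`
(`ω(y⁻¹) = ω(y)` ★ `quadraticArtinIndicator_inv`). [cite: Rogawski1990, §7.3 (7.3.2) (p. 96)] [cite: Folland1995, §2.6 Thm. 2.49] -/
theorem integral_ideleNorm_sq_inv_smul_comp_inv_mul_quadraticChar_eq (d : F)
    (μF : Measure (AdeleRing (𝓞 F) F)ˣ) [IsHaarMeasure μF] (Ψ : (AdeleRing (𝓞 F) F)ˣ → ℂ) :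
    ∫ y, ((((IdeleClassGroup.ideleNorm F y ^ 2)⁻¹ : ℝ≥0) : ℝ) • Ψ y⁻¹) *
        (-1 : ℂ) ^ (GaloisRepresentations.quadraticArtinIndicator F d y).val ∂μF =
      ∫ y, (((IdeleClassGroup.ideleNorm F y ^ 2 : ℝ≥0) : ℝ) • Ψ y) *
        (-1 : ℂ) ^ (GaloisRepresentations.quadraticArtinIndicator F d y).val ∂μF := by
  rw [← integral_comp_inv_eq μF (fun y => (((IdeleClassGroup.ideleNorm F y ^ 2 : ℝ≥0) : ℝ) • Ψ y) *
    (-1 : ℂ) ^ (GaloisRepresentations.quadraticArtinIndicator F d y).val)]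
  refine integral_congr_ae (ae_of_all _ fun y => ?_)
  simp only [ideleClassGroup_ideleNorm_inv, inv_pow, GaloisRepresentations.quadraticArtinIndicator_inv]

end IndexTwo

section PrintForm

variable [Algebra.IsQuadraticExtension F E]
  [MeasurableSpace (quasiSplit F E c 3).Adelic] [BorelSpace (quasiSplit F E c 3).Adelic]
  [MeasurableSpace (AdeleRing (𝓞 F) F)ˣ] [BorelSpace (AdeleRing (𝓞 F) F)ˣ]

/-- **THE CENTRE-LATTICE PART IN THE PRINTED FORM [Rogawski1990, Prop. 7.3.2 (c)+(d)]**: same data as ★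
`exists_integrable_and_integral_weight_smul_centrePart_eq`; ONE constant `C > 0` with, for every `z₁ = ι(ratCenter ζ)`,
every `f ∈ C_c(G(𝔸))` and every covering weight `β` of `B(F)♯` (given `μ_N(Ω) < ∞`):

  `∫ β • ψᶜ_f dν_G = C · μ_N(Ω) · (½ ∫_{𝕀_F} ‖y‖² • Ψ_f(y) dμ_F + ½ ∫_{𝕀_F} (‖y‖² • Ψ_f(y)) ω(y) dμ_F)`,
  `Ψ_f(y) = ∫_{K_U} f(k⁻¹ z₁ n(θ(y)) k) dμ_K`, `ω = ω_{E/F} = (−1)^{[·]}`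

— the two terms `χ = 1` (c) and `χ = ω` (d) of `½ m Σ_χ ∫_{I_F} f^K(z n(tδ₀)) χ(t) ‖t‖² d^*t` (§3 + ★
`setIntegral_normClasses_eq_half_add_half_integral_mul_quadraticChar` with `g ∈ L¹(𝕀_F)` by ★ (C-γ-fin)
`integrable_ideleNorm_sq_inv_smul_centreProfile` + the flip ★ `integral_ideleNorm_sq_inv_smul_comp_inv_eq`).
[cite: Rogawski1990, §7.3 (7.3.2) and Prop. 7.3.2 (c), (d) (pp. 96–97)] [cite: Arthur1981TraceFormulaInvariantForm, §2] -/
theorem exists_integral_weight_smul_centrePart_eq_half_add_half (hc : c * c = 1) (hc1 : c ≠ 1)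
    {δ : E} (hcδ : c δ = -δ) (hδ : δ ≠ 0) (θ : 𝓞 F) (hθ : θ ≠ 0) (hd : δ * δ = algebraMap F E (θ : F))
    (νG : Measure (quasiSplit F E c 3).Adelic) [νG.IsHaarMeasure]
    (μB : Measure (borelAdelic F E c 3)) [μB.IsHaarMeasure]
    (μK : Measure ((standardMaximalCompactGL 3 E).comap
      (adelicVal F E c 3 ((StdForm.antidiagonal 3).over E)) : Subgroup (quasiSplit F E c 3).Adelic))
    [μK.IsHaarMeasure]
    (μT : Measure (torusInBorel F E c 3)) [μT.IsHaarMeasure]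
    (μN : Measure (unipotentInBorel F E c 3)) [μN.IsHaarMeasure]
    (hBK : ∀ g : (quasiSplit F E c 3).Adelic, ∃ b ∈ borelAdelic F E c 3, ∃ k : (quasiSplit F E c 3).Adelic,
      adelicVal F E c 3 ((StdForm.antidiagonal 3).over E) k ∈ standardMaximalCompactGL 3 E ∧ g = b * k)
    {Ω : Set (unipotentInBorel F E c 3)} (hΩ : MeasurableSet Ω)
    (hΩu : ∀ n : unipotentInBorel F E c 3,
      ∃! ν : (((quasiSplit F E c 3).arithmeticSubgroup).subgroupOf (borelAdelic F E c 3)).subgroupOf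
        (unipotentInBorel F E c 3), ν • n ∈ Ω)
    (hΩfin : μN Ω ≠ ∞)
    {wT : torusInBorel F E c 3 → ℝ≥0∞}
    (hwT : IsCoveringWeight ((((quasiSplit F E c 3).arithmeticSubgroup).subgroupOf (borelAdelic F E c 3)).subgroupOf
      (torusInBorel F E c 3)) wT)
    (μF : Measure (AdeleRing (𝓞 F) F)ˣ) [IsHaarMeasure μF] :
    ∃ C : ℝ≥0, 0 < C ∧
      ∀ (ζ : ratOne F E c) {z₁ : (quasiSplit F E c 3).arithmeticSubgroup},
        (z₁ : (quasiSplit F E c 3).Adelic) =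
          (quasiSplit F E c 3).toAdelic (ratCenter F E c 3 ((StdForm.antidiagonal 3).over E) ζ) →
      ∀ {f : (quasiSplit F E c 3).Adelic → ℂ}, Continuous f → HasCompactSupport f →
      ∀ {β : (quasiSplit F E c 3).Adelic → ℝ≥0∞},
        IsCoveringWeight ((arithmeticBorel F E c 3).map (quasiSplit F E c 3).arithmeticSubgroup.subtype) β →
        ∫ g, (β g).toReal •
          ∑' w : {w : rationalTraceZero F E c // w ≠ 0},
            f (g⁻¹ * ((z₁ : (quasiSplit F E c 3).Adelic) *
              (((heisChart hc ((0 : AdeleRing (𝓞 E) E), ((w.1 : rationalTraceZero F E c) : traceZeroAdele F E c))) :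
                adelicUnipotent F E c 3) : (quasiSplit F E c 3).Adelic)) * g) ∂νG =
          ((C : ℝ) : ℂ) * (μN.real Ω : ℂ) *
            ((1 / 2 : ℂ) * ∫ y, ((IdeleClassGroup.ideleNorm F y ^ 2 : ℝ≥0) : ℝ) •
                ∫ k, f ((k : (quasiSplit F E c 3).Adelic)⁻¹ * ((z₁ : (quasiSplit F E c 3).Adelic) *
                  ((heisChart hc ((0 : AdeleRing (𝓞 E) E),
                      traceZeroLine F E c hcδ hδ ((y : (AdeleRing (𝓞 F) F)ˣ) : AdeleRing (𝓞 F) F)) :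
                    adelicUnipotent F E c 3) : (quasiSplit F E c 3).Adelic)) * (k : (quasiSplit F E c 3).Adelic)) ∂μK ∂μF +
             (1 / 2 : ℂ) * ∫ y, (((IdeleClassGroup.ideleNorm F y ^ 2 : ℝ≥0) : ℝ) •
                ∫ k, f ((k : (quasiSplit F E c 3).Adelic)⁻¹ * ((z₁ : (quasiSplit F E c 3).Adelic) *
                  ((heisChart hc ((0 : AdeleRing (𝓞 E) E),
                      traceZeroLine F E c hcδ hδ ((y : (AdeleRing (𝓞 F) F)ˣ) : AdeleRing (𝓞 F) F)) :
                    adelicUnipotent F E c 3) : (quasiSplit F E c 3).Adelic)) * (k : (quasiSplit F E c 3).Adelic)) ∂μK) *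
                (-1 : ℂ) ^ (GaloisRepresentations.quadraticArtinIndicator F (θ : F) y).val ∂μF) := by
  obtain ⟨C, hC, h⟩ := exists_integrable_and_integral_weight_smul_centrePart_eq hc hc1 hcδ hδ θ hθ hd νG μB μK μT μN hBK
    hΩ hΩu hΩfin hwT μF
  refine ⟨C, hC, fun ζ z₁ hz₁ f hfc hf β hβ => ?_⟩
  obtain ⟨-, hval⟩ := h ζ hz₁ hfc hf hβ
  -- the norm profile as `Ψ_f ∘ (·)⁻¹`
  set Ψ : (AdeleRing (𝓞 F) F)ˣ → ℂ := fun y =>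
    ∫ k, f ((k : (quasiSplit F E c 3).Adelic)⁻¹ * ((z₁ : (quasiSplit F E c 3).Adelic) *
      ((heisChart hc ((0 : AdeleRing (𝓞 E) E),
          traceZeroLine F E c hcδ hδ ((y : (AdeleRing (𝓞 F) F)ˣ) : AdeleRing (𝓞 F) F)) :
        adelicUnipotent F E c 3) : (quasiSplit F E c 3).Adelic)) * (k : (quasiSplit F E c 3).Adelic)) ∂μK with hΨ
  have hint := integrable_ideleNorm_sq_inv_smul_centreProfile hc hcδ hδ (z₁ : (quasiSplit F E c 3).Adelic) μK μF hfc hf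
  rw [hval, setIntegral_normClasses_eq_half_add_half_integral_mul_quadraticChar (θ : F) μF hint]
  have h1 := integral_ideleNorm_sq_inv_smul_comp_inv_eq μF Ψ
  have h2 := integral_ideleNorm_sq_inv_smul_comp_inv_mul_quadraticChar_eq (θ : F) μF Ψ
  simp only [hΨ] at h1 h2
  rw [h1, h2]

end PrintForm

end UnitaryGroup

end Literature.NumberTheory.Automorphic

end
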